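import Summits.ResolutionOfSingularities.ResolutionOfSingularities.Theorems.RadicialJungCleanModelsDoublingHEmb
import Summits.ResolutionOfSingularities.ResolutionOfSingularities.Theorems.RadicialJungCleanModelsDoublingRing
import Literature.AlgebraicGeometry.CossartPiltant200819.GoodResolution2019
import Literature.AlgebraicGeometry.Resolution.ExcellentRingsFieldProofs
import Literature.AlgebraicGeometry.Resolution.EtaleVanishingIdeal
import Literature.AlgebraicGeometry.Resolution.RegularLocalRingsProofs
import Literature.AlgebraicGeometry.Resolution.AlterationsResolution
import Literature.AlgebraicGeometry.Motives.GoodReductionSpecialFibreProofs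
import Literature.AlgebraicGeometry.Morphisms.SectionEqualizerClopen
import Literature.AlgebraicGeometry.Morphisms.IsoOverOpen
import Mathlib.AlgebraicGeometry.Morphisms.Finite
import HarnessLib

/-!
# The doubling trick in every dimension: `hEmb` for `V(x) ⊂ Spec R` from a good resolution of `Spec R[t]/(t² − x t)`

Crux `RadicialJung.CleanModels` (stmt-ResolutionOfSingularities-15917).  `RadicialJungCleanModelsDoublingHEmb.lean`
(decomp-res-hand-1 g0, ✓ p789446) proves the embedded-resolution shape `hEmb` (CJS 2020 Cor. 1.5) for a hypersurface
`V(x) ⊂ Spec R`, `R` an excellent regular domain of Krull dimension `≤ 3`, from the VERBATIM typing of Cossart–Piltant 2019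
Thm. 1.1 (i)(ii)(iii) (`CP2019.CossartPiltant2019Thm11`), by the doubling trick: a good resolution of the reduced scheme
`Y = Spec R[t]/(t² − x t)` (two copies of `Spec R` glued along `V(x)`, `Sing Y = V(t, x) ≅ V(x)`) restricted to the clopen
component over the sheet `t = 0`.  The ONLY place where that proof uses the dimension bound and the printed theorem is to GET
the good resolution of `Y`.  This file separates the two:

* `hEmb_zeroLocus_of_hasGoodResolution` — DIMENSION-FREE ENGINE: for `R` a regular (Noetherian) domain and `0 ≠ x ∈ R`, ANY good
  resolution of `Spec R[t]/(t² − x t)` (`CP2019.HasGoodResolution`, the conclusion of CP 2019 Thm. 1.1: proper birational from a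
  regular scheme, an isomorphism over the regular locus, preimage of the singular locus a strict normal crossings divisor) yields
  a proper surjective `π : Z' → Spec R`, an isomorphism over `D(x)`, with `π⁻¹(V(x))` a strict normal crossings divisor on `Z'`.
  The proof is g0's, verbatim after its first eight lines.
* `hEmb_zeroLocus_of_goodResolutionLE` — the named-hypothesis form in dimension `≤ d`: «every reduced separated Noetherian
  quasi-excellent scheme of dimension `≤ d` has a good resolution» (for `d = 3` this hypothesis is, token for token up to the
  numeral cast, `CP2019.CossartPiltant2019Thm11`; for `d ≥ 4` it is an OPEN statement — log-resolution of excellent schemes — and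
  is taken here only as a hypothesis shape, never asserted) implies `hEmb` for every hypersurface `V(x)` of every excellent
  regular domain `R` of Krull dimension `≤ d`.  Use: the `dim W ≥ 4` inputs (7a)/(7b) of `stub_cleanModelsDimGEFour`
  (decomp-res-hand-2: clean LU at defectless / Abhyankar valuations modulo an embedded-resolution hypothesis `hEmb_N` for
  hypersurfaces of regular `(N+1)`-folds) can cite good resolution in dimension `≤ N + 1` instead, through this engine, exactly as
  the dim-3 slice cites Thm. 1.1 through `hEmb_zeroLocus_of_thm11`.

Honest framing: re-accounting of hypothesis SHAPES through a kernel engine; nothing here proves resolution of singularities in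
characteristic `p`, and no statement about dimension `≥ 4` is asserted.
-/

noncomputable section

-- lint debt: the summit's namespace repeats `ResolutionOfSingularities` (summit = problem), as in every file here.
set_option linter.dupNamespace false

open Polynomial IsLocalRing CategoryTheory AlgebraicGeometry TopologicalSpace
open Literature.AlgebraicGeometry.Resolution Literature.AlgebraicGeometry.CossartPiltant200819

namespace Summit.ResolutionOfSingularities.ResolutionOfSingularities.Theorems.RadicialJung.CleanModels.Doubling

universe u

/-- **The doubling trick, dimension-free.**  For `R` a regular domain (Noetherian, all local rings regular) and `0 ≠ x ∈ R`,
a good resolution of the reduced scheme `Y = Spec R[t]/(t² − x t)` in the sense of Cossart–Piltant 2019 (`CP2019.HasGoodResolution`: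
`Y'` regular, `π` proper birational, an isomorphism over `Reg Y`, `π⁻¹(Sing Y)` a strict normal crossings divisor) yields a proper
surjective `π₀ : Z' → Spec R`, an isomorphism over `D(x)`, with `π₀⁻¹(V(x))` a strict normal crossings divisor on `Z'` — the shape
`hEmb (Spec R) … (V(x)) …` in which the line consumes CJS 2020 Cor. 1.5.  Proof (decomp-res-hand-1 g0, `hEmb_zeroLocus_of_thm11`,
verbatim from its ninth line): `Sing Y = V(t, x)`; the clopen piece `W = Y' ∖ closure (π⁻¹(sheet t = x ∖ V(x)))` of the regular `Y'`
maps properly onto the sheet `t = 0 ≅ Spec R`, isomorphically over `D(x)`, and `W ∩ π⁻¹(V(x))` is the snc divisor `π⁻¹(Sing Y)`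
restricted to an open. [cite: CossartPiltant2019, Thm. 1.1 and p. 3 («good resolution»)] -/
theorem hEmb_zeroLocus_of_hasGoodResolution
    (R : Type u) [CommRing R] [IsDomain R] [IsRegularRing R] (x : R) (hx : x ≠ 0)
    (hgood : CP2019.HasGoodResolution (Spec (.of (AdjoinRoot (X ^ 2 - C x * X))))) :
    ∃ (Z' : Scheme.{u}) (π : Z' ⟶ Spec (.of R)), IsProper π ∧ Function.Surjective π.base ∧
      (∃ U : (Spec (.of R)).Opens,
        (U : Set ↥(Spec (.of R))) = (PrimeSpectrum.zeroLocus ({x} : Set R) : Set (PrimeSpectrum R))ᶜ ∧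
        IsIso (π ∣_ U)) ∧
      IsStrictNormalCrossingsDivisor Z'
        (π.base ⁻¹' (PrimeSpectrum.zeroLocus ({x} : Set R) : Set (PrimeSpectrum R))) := by
  classical
  -- the doubled ring `S = R[t]/(t² - x t)` and `Y = Spec S → Spec R` (finite over the Noetherian `R`)
  haveI hfinS : Module.Finite R (AdjoinRoot (X ^ 2 - C x * X)) := moduleFinite x
  haveI : IsNoetherianRing (AdjoinRoot (X ^ 2 - C x * X)) := inferInstance
  -- a good resolution of `Y` (hypothesis)
  obtain ⟨Y', π, hgood⟩ := hgood
  obtain ⟨⟨hproper, hbir, hY'reg⟩, ⟨U, hU, hUiso⟩, hsnc⟩ := hgood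
  haveI := hproper
  haveI := hUiso
  haveI : IsLocallyNoetherian Y' := LocallyOfFiniteType.isLocallyNoetherian π
  -- the structure map `q : Y → Spec R` (finite)
  haveI : IsFinite (Spec.map (CommRingCat.ofHom (algebraMap R (AdjoinRoot (X ^ 2 - C x * X))))) := by
    rw [IsFinite.SpecMap_iff, CommRingCat.hom_ofHom]
    exact RingHom.finite_algebraMap.mpr hfinS
  -- the regular locus of `Y` is the complement of `V(x)`
  have hreg : ∀ P : ↥(Spec (.of (AdjoinRoot (X ^ 2 - C x * X)))),
      P ∈ Scheme.regularLocus (Spec (.of (AdjoinRoot (X ^ 2 - C x * X)))) ↔ AdjoinRoot.of _ x ∉ P.asIdeal :=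
    fun P => isRegularLocalRing_stalk_iff_not_mem x hx P
  -- the chart `t - x ≠ 0` (sheet `t = 0` off `V(x)`) as the range of `Spec S[1/(t - x)] → Y`
  obtain ⟨ι₀, hι₀⟩ : ∃ ι₀ : Spec (.of (Localization.Away (AdjoinRoot.root (X ^ 2 - C x * X) - AdjoinRoot.of _ x))) ⟶
      Spec (.of (AdjoinRoot (X ^ 2 - C x * X))), ι₀ = Spec.map (CommRingCat.ofHom (algebraMap _ _)) := ⟨_, rfl⟩
  haveI hι₀oi : IsOpenImmersion ι₀ := by rw [hι₀]; infer_instance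
  have hO₀ : ∀ P, P ∈ ι₀.opensRange ↔ AdjoinRoot.root (X ^ 2 - C x * X) - AdjoinRoot.of _ x ∉ P.asIdeal := by
    intro P
    have h := PrimeSpectrum.localization_away_comap_range
      (Localization.Away (AdjoinRoot.root (X ^ 2 - C x * X) - AdjoinRoot.of _ x))
      (AdjoinRoot.root (X ^ 2 - C x * X) - AdjoinRoot.of _ x)
    have h' : Set.range ι₀.base = Set.range (PrimeSpectrum.comap (algebraMap (AdjoinRoot (X ^ 2 - C x * X))
        (Localization.Away (AdjoinRoot.root (X ^ 2 - C x * X) - AdjoinRoot.of _ x)))) := by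
      rw [hι₀]; rfl
    change P ∈ (ι₀.opensRange : Set _) ↔ _
    rw [Scheme.Hom.coe_opensRange, h', h]
    rfl
  have hO₀U : ι₀.opensRange ≤ U := by
    intro P hP
    rw [← SetLike.mem_coe, hU]
    exact (hreg P).mpr fun hxP => (hO₀ P).mp hP (root_mem_of_mem x P.asIdeal hxP).2
  haveI hisoO₀ : IsIso (π ∣_ ι₀.opensRange) :=
    Literature.AlgebraicGeometry.Morphisms.isIso_morphismRestrict_of_le π hO₀U
  -- the chart `t ≠ 0` of `Y` (sheet `t = x` off `V(x)`) and its preimage `V₁`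
  obtain ⟨O₁, hO₁⟩ : ∃ O₁ : (Spec (.of (AdjoinRoot (X ^ 2 - C x * X)))).Opens,
      ∀ P, P ∈ O₁ ↔ AdjoinRoot.root (X ^ 2 - C x * X) ∉ P.asIdeal :=
    ⟨⟨{P | AdjoinRoot.root (X ^ 2 - C x * X) ∉ P.asIdeal}, (PrimeSpectrum.basicOpen _).isOpen⟩, fun P => Iff.rfl⟩
  have hO₀O₁ : ∀ P, P ∈ ι₀.opensRange → P ∈ O₁ → False := by
    intro P h0 h1
    rw [hO₀] at h0
    rw [hO₁] at h1
    rcases P.isPrime.mem_or_mem ((root_mul_root_sub x).symm ▸ P.asIdeal.zero_mem :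
      AdjoinRoot.root (X ^ 2 - C x * X) * (AdjoinRoot.root (X ^ 2 - C x * X) - AdjoinRoot.of _ x) ∈ P.asIdeal)
      with h | h
    · exact h1 h
    · exact h0 h
  have hO₀O₁' : ∀ P : ↥(Spec (.of (AdjoinRoot (X ^ 2 - C x * X)))), AdjoinRoot.of _ x ∉ P.asIdeal →
      P ∈ ι₀.opensRange ∨ P ∈ O₁ := by
    intro P hP
    rw [hO₀, hO₁]
    rcases root_mem_or_of_not_mem x P.asIdeal hP with ⟨-, h⟩ | ⟨h, -⟩
    · exact Or.inl h
    · exact Or.inr h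
  -- `W = Y' ∖ closure (π⁻¹ O₁)` is clopen (the component of `Y'` over the sheet `t = 0`)
  have hclopen : IsOpen (closure ((π ⁻¹ᵁ O₁ : Y'.Opens) : Set Y')) := by
    rw [isOpen_iff_forall_mem_open]
    intro y hy
    haveI := hY'reg y
    haveI : IsDomain (Y'.presheaf.stalk y) := isDomain_of_isRegularLocalRing (R := Y'.presheaf.stalk y)
    obtain ⟨N, hNo, hyN, hNirr⟩ :=
      Literature.AlgebraicGeometry.Motives.exists_isOpen_isIrreducible_of_isDomain_stalk Y' y
    refine ⟨N, fun z hz => ?_, hNo, hyN⟩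
    have hne : (N ∩ ((π ⁻¹ᵁ O₁ : Y'.Opens) : Set Y')).Nonempty := mem_closure_iff.mp hy N hNo hyN
    rw [mem_closure_iff]
    intro o ho hzo
    obtain ⟨w, -, hwo, hwV⟩ := hNirr.isPreirreducible o _ ho (π ⁻¹ᵁ O₁).isOpen ⟨z, hz, hzo⟩ hne
    exact ⟨w, hwo, hwV⟩
  obtain ⟨W, hW⟩ : ∃ W : Y'.Opens, (W : Set Y') = (closure ((π ⁻¹ᵁ O₁ : Y'.Opens) : Set Y'))ᶜ :=
    ⟨⟨_, isClosed_closure.isOpen_compl⟩, rfl⟩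
  have hWmem : ∀ y, y ∈ W ↔ y ∉ closure ((π ⁻¹ᵁ O₁ : Y'.Opens) : Set Y') := fun y => by
    rw [← SetLike.mem_coe, hW]; rfl
  have hWclosed : IsClosed (W : Set Y') := by rw [hW]; exact hclopen.isClosed_compl
  haveI : IsClosedImmersion W.ι := Literature.AlgebraicGeometry.Morphisms.isClosedImmersion_ι_of_isClosed W hWclosed
  have hV₀W : π ⁻¹ᵁ ι₀.opensRange ≤ W := by
    have hdisj : Disjoint ((π ⁻¹ᵁ ι₀.opensRange : Y'.Opens) : Set Y') ((π ⁻¹ᵁ O₁ : Y'.Opens) : Set Y') := by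
      rw [Set.disjoint_left]
      intro z hz0 hz1
      exact hO₀O₁ (π.base z) hz0 hz1
    intro y hy
    rw [hWmem]
    exact Set.disjoint_left.mp (hdisj.closure_right (π ⁻¹ᵁ ι₀.opensRange).isOpen) hy
  have hWV₁ : ∀ y, y ∈ W → π.base y ∉ O₁ := by
    intro y hy h1
    exact (hWmem y).mp hy (subset_closure h1)
  -- `π` is surjective (proper and birational)
  have hπsurj : Function.Surjective π.base := by
    have hd : DenseRange π.base := hbir.isDominant.denseRange
    have hc : IsClosed (Set.range π.base) := π.isClosedMap.isClosed_range
    rw [← Set.range_eq_univ, ← hc.closure_eq, hd.closure_range]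
  -- the sheet `t = 0`: `j₀ : Spec R → Y`, a section of `q`
  obtain ⟨j₀, hj₀⟩ : ∃ j₀ : Spec (.of R) ⟶ Spec (.of (AdjoinRoot (X ^ 2 - C x * X))),
      j₀ = Spec.map (CommRingCat.ofHom (AdjoinRoot.lift (RingHom.id R) (0 : R) (eval₂_zero x))) := ⟨_, rfl⟩
  have hj₀asIdeal : ∀ p : ↥(Spec (.of R)), (j₀.base p).asIdeal =
      p.asIdeal.comap (AdjoinRoot.lift (RingHom.id R) (0 : R) (eval₂_zero x)) := by
    intro p; rw [hj₀]; rfl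
  have hqasIdeal : ∀ P : ↥(Spec (.of (AdjoinRoot (X ^ 2 - C x * X)))),
      ((Spec.map (CommRingCat.ofHom (algebraMap R (AdjoinRoot (X ^ 2 - C x * X))))).base P).asIdeal =
        P.asIdeal.comap (algebraMap R (AdjoinRoot (X ^ 2 - C x * X))) := fun P => rfl
  have hqj₀ : ∀ p : ↥(Spec (.of R)),
      (Spec.map (CommRingCat.ofHom (algebraMap R (AdjoinRoot (X ^ 2 - C x * X))))).base (j₀.base p) = p := by
    intro p
    apply PrimeSpectrum.ext
    rw [hqasIdeal, hj₀asIdeal, Ideal.comap_comap]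
    ext r
    rw [Ideal.mem_comap]
    simp [AdjoinRoot.algebraMap_eq]
  have hj₀O₀ : ∀ p : ↥(Spec (.of R)), x ∉ p.asIdeal → j₀.base p ∈ ι₀.opensRange := by
    intro p hp
    rw [hO₀, hj₀asIdeal, Ideal.mem_comap]
    simpa [AdjoinRoot.lift_root, AdjoinRoot.lift_of] using hp
  -- surjectivity of `π₀ = W.ι ≫ π ≫ q`
  have himgW : ∀ p : ↥(Spec (.of R)), ∃ y : Y', y ∈ W ∧ π.base y = j₀.base p := by
    intro p
    have hWimg_closed : IsClosed (π.base '' (W : Set Y')) := π.isClosedMap _ hWclosed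
    have hO₀sub : (ι₀.opensRange : Set _) ⊆ π.base '' (W : Set Y') := by
      intro P hP
      obtain ⟨y, hy⟩ := hπsurj P
      exact ⟨y, hV₀W (show π.base y ∈ ι₀.opensRange from hy ▸ hP), hy⟩
    have hDx : Dense ((PrimeSpectrum.basicOpen x : Opens (PrimeSpectrum R)) : Set (PrimeSpectrum R)) := by
      refine (PrimeSpectrum.basicOpen x).isOpen.dense ⟨⟨⊥, Ideal.isPrime_bot⟩, ?_⟩
      simpa using hx
    have hsub : ((PrimeSpectrum.basicOpen x : Opens (PrimeSpectrum R)) : Set (PrimeSpectrum R)) ⊆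
        j₀.base ⁻¹' (ι₀.opensRange : Set _) := fun p' hp' => hj₀O₀ p' hp'
    have hcl : j₀.base p ∈ closure (ι₀.opensRange : Set _) := by
      have hp : (p : PrimeSpectrum R) ∈ closure ((PrimeSpectrum.basicOpen x : Opens (PrimeSpectrum R)) :
          Set (PrimeSpectrum R)) := hDx p
      have := image_closure_subset_closure_image j₀.base.hom.continuous ⟨p, hp, rfl⟩
      exact closure_mono (Set.image_subset_iff.mpr hsub) this
    have hmem : j₀.base p ∈ π.base '' (W : Set Y') := (hWimg_closed.closure_subset_iff.mpr hO₀sub) hcl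
    obtain ⟨y, hyW, hy⟩ := hmem
    exact ⟨y, hyW, hy⟩
  have hπ₀surj : Function.Surjective
      (W.ι ≫ π ≫ Spec.map (CommRingCat.ofHom (algebraMap R (AdjoinRoot (X ^ 2 - C x * X))))).base := by
    intro p
    obtain ⟨y, hyW, hy⟩ := himgW p
    refine ⟨⟨y, hyW⟩, ?_⟩
    change (Spec.map (CommRingCat.ofHom (algebraMap R (AdjoinRoot (X ^ 2 - C x * X))))).base (π.base y) = p
    rw [hy, hqj₀]
  -- the open `D(x) ⊆ Spec R`
  obtain ⟨Ux, hUx⟩ : ∃ Ux : (Spec (.of R)).Opens, ∀ p, p ∈ Ux ↔ x ∉ p.asIdeal :=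
    ⟨⟨{p | x ∉ p.asIdeal}, (PrimeSpectrum.basicOpen x).isOpen⟩, fun p => Iff.rfl⟩
  -- points of `W` over `D(x)` are exactly the points of `π⁻¹ O₀`
  have hpre : ∀ w : ↥W, w ∈ (W.ι ≫ π ≫ Spec.map (CommRingCat.ofHom (algebraMap R (AdjoinRoot (X ^ 2 - C x * X))))) ⁻¹ᵁ Ux
      ↔ π.base w.1 ∈ ι₀.opensRange := by
    intro w
    change (Spec.map (CommRingCat.ofHom (algebraMap R (AdjoinRoot (X ^ 2 - C x * X))))).base (π.base w.1) ∈ Ux ↔ _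
    rw [hUx, hqasIdeal, Ideal.mem_comap, AdjoinRoot.algebraMap_eq]
    constructor
    · intro hx'
      rcases hO₀O₁' _ hx' with h | h
      · exact h
      · exact absurd h (hWV₁ w.1 w.2)
    · intro h hx'
      rw [hO₀] at h
      exact h (root_mem_of_mem x _ hx').2
  refine ⟨W, W.ι ≫ π ≫ Spec.map (CommRingCat.ofHom (algebraMap R (AdjoinRoot (X ^ 2 - C x * X)))), inferInstance,
    hπ₀surj, ⟨Ux, ?_, ?_⟩, ?_⟩
  · -- `Ux = D(x)`
    ext p
    rw [SetLike.mem_coe, hUx]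
    change _ ↔ ¬ (({x} : Set R) ⊆ p.asIdeal)
    rw [Set.singleton_subset_iff]
    rfl
  · -- `π₀` is an isomorphism over `D(x)`: an open immersion (it is `π⁻¹ O₀ ≅ O₀ ≅ Spec R[1/x] ⊆ Spec R`) and surjective
    have hrange : Set.range (((W.ι ≫ π ≫ Spec.map (CommRingCat.ofHom (algebraMap R (AdjoinRoot (X ^ 2 - C x * X))))) ⁻¹ᵁ
        Ux).ι ≫ W.ι).base = Set.range (π ⁻¹ᵁ ι₀.opensRange).ι.base := by
      rw [Scheme.Opens.range_ι]
      ext y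
      constructor
      · rintro ⟨w, rfl⟩
        exact (hpre w.1).mp w.2
      · intro hy
        exact ⟨⟨⟨y, hV₀W hy⟩, (hpre ⟨y, hV₀W hy⟩).mpr hy⟩, rfl⟩
    haveI : IsOpenImmersion (((W.ι ≫ π ≫ Spec.map (CommRingCat.ofHom (algebraMap R (AdjoinRoot (X ^ 2 - C x * X))))) ⁻¹ᵁ
        Ux).ι ≫ (W.ι ≫ π ≫ Spec.map (CommRingCat.ofHom (algebraMap R (AdjoinRoot (X ^ 2 - C x * X)))))) := by
      have h1 : ((W.ι ≫ π ≫ Spec.map (CommRingCat.ofHom (algebraMap R (AdjoinRoot (X ^ 2 - C x * X))))) ⁻¹ᵁ Ux).ι ≫ W.ι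
          = (IsOpenImmersion.isoOfRangeEq _ _ hrange).hom ≫ (π ⁻¹ᵁ ι₀.opensRange).ι :=
        (IsOpenImmersion.isoOfRangeEq_hom_fac _ _ hrange).symm
      have h2 : (π ⁻¹ᵁ ι₀.opensRange).ι ≫ π = (π ∣_ ι₀.opensRange) ≫ ι₀.opensRange.ι :=
        (morphismRestrict_ι _ _).symm
      have h3 : ι₀.opensRange.ι = ι₀.isoOpensRange.inv ≫ ι₀ := by
        rw [Iso.eq_inv_comp, Scheme.Hom.isoOpensRange_hom_ι]
      have hfac : ((W.ι ≫ π ≫ Spec.map (CommRingCat.ofHom (algebraMap R (AdjoinRoot (X ^ 2 - C x * X))))) ⁻¹ᵁ Ux).ι ≫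
          (W.ι ≫ π ≫ Spec.map (CommRingCat.ofHom (algebraMap R (AdjoinRoot (X ^ 2 - C x * X))))) =
          (IsOpenImmersion.isoOfRangeEq _ _ hrange).hom ≫ (π ∣_ ι₀.opensRange) ≫ ι₀.isoOpensRange.inv ≫ ι₀ ≫
            Spec.map (CommRingCat.ofHom (algebraMap R (AdjoinRoot (X ^ 2 - C x * X)))) :=
        calc ((W.ι ≫ π ≫ Spec.map (CommRingCat.ofHom (algebraMap R (AdjoinRoot (X ^ 2 - C x * X))))) ⁻¹ᵁ Ux).ι ≫
              (W.ι ≫ π ≫ Spec.map (CommRingCat.ofHom (algebraMap R (AdjoinRoot (X ^ 2 - C x * X)))))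
            = (((W.ι ≫ π ≫ Spec.map (CommRingCat.ofHom (algebraMap R (AdjoinRoot (X ^ 2 - C x * X))))) ⁻¹ᵁ Ux).ι ≫
                W.ι) ≫ π ≫ Spec.map (CommRingCat.ofHom (algebraMap R (AdjoinRoot (X ^ 2 - C x * X)))) := by
              simp only [Category.assoc]
          _ = ((IsOpenImmersion.isoOfRangeEq _ _ hrange).hom ≫ (π ⁻¹ᵁ ι₀.opensRange).ι) ≫ π ≫
                Spec.map (CommRingCat.ofHom (algebraMap R (AdjoinRoot (X ^ 2 - C x * X)))) :=
              congrArg (· ≫ π ≫ Spec.map (CommRingCat.ofHom (algebraMap R (AdjoinRoot (X ^ 2 - C x * X))))) h1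
          _ = (IsOpenImmersion.isoOfRangeEq _ _ hrange).hom ≫ ((π ⁻¹ᵁ ι₀.opensRange).ι ≫ π) ≫
                Spec.map (CommRingCat.ofHom (algebraMap R (AdjoinRoot (X ^ 2 - C x * X)))) := by
              simp only [Category.assoc]
          _ = (IsOpenImmersion.isoOfRangeEq _ _ hrange).hom ≫ ((π ∣_ ι₀.opensRange) ≫ ι₀.opensRange.ι) ≫
                Spec.map (CommRingCat.ofHom (algebraMap R (AdjoinRoot (X ^ 2 - C x * X)))) := by rw [h2]
          _ = _ := by rw [h3]; simp only [Category.assoc]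
      rw [hfac]
      haveI : IsOpenImmersion (ι₀ ≫ Spec.map (CommRingCat.ofHom (algebraMap R (AdjoinRoot (X ^ 2 - C x * X))))) := by
        have : ι₀ ≫ Spec.map (CommRingCat.ofHom (algebraMap R (AdjoinRoot (X ^ 2 - C x * X)))) =
            Spec.map (CommRingCat.ofHom (algebraMap R
              (Localization.Away (AdjoinRoot.root (X ^ 2 - C x * X) - AdjoinRoot.of _ x)))) := by
          rw [hι₀, ← Spec.map_comp, ← CommRingCat.ofHom_comp, ← IsScalarTower.algebraMap_eq]
        rw [this]
        haveI := isLocalization_away_of_away_root_sub x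
          (Localization.Away (AdjoinRoot.root (X ^ 2 - C x * X) - AdjoinRoot.of _ x))
        exact IsOpenImmersion.of_isLocalization x
      infer_instance
    haveI : IsOpenImmersion (((W.ι ≫ π ≫ Spec.map (CommRingCat.ofHom (algebraMap R (AdjoinRoot (X ^ 2 - C x * X))))) ∣_ Ux)
        ≫ Ux.ι) := by
      rw [morphismRestrict_ι]; infer_instance
    haveI : IsOpenImmersion ((W.ι ≫ π ≫ Spec.map (CommRingCat.ofHom (algebraMap R (AdjoinRoot (X ^ 2 - C x * X))))) ∣_ Ux) :=
      IsOpenImmersion.of_comp _ Ux.ι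
    refine (isIso_iff_isOpenImmersion_and_surjective _).mpr ⟨inferInstance, ⟨?_⟩⟩
    rintro ⟨p, hp⟩
    have hxp : x ∉ p.asIdeal := (hUx p).mp hp
    obtain ⟨y, hy⟩ := hπsurj (j₀.base p)
    have hy0 : y ∈ π ⁻¹ᵁ ι₀.opensRange := show π.base y ∈ _ from hy ▸ hj₀O₀ p hxp
    have hyW : y ∈ W := hV₀W hy0
    refine ⟨⟨⟨y, hyW⟩, (hpre ⟨y, hyW⟩).mpr (hy ▸ hj₀O₀ p hxp)⟩, ?_⟩
    apply Subtype.ext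
    rw [morphismRestrict_base_coe]
    change (Spec.map (CommRingCat.ofHom (algebraMap R (AdjoinRoot (X ^ 2 - C x * X))))).base (π.base y) = p
    rw [hy, hqj₀]
  · -- the total transform of `V(x)` is the snc divisor `π⁻¹(Sing Y)` restricted to the clopen `W`
    have hsnc' := hsnc.preimage_of_etale W.ι
    convert hsnc' using 1
    ext w
    rw [Set.mem_preimage, Set.mem_preimage, Set.mem_preimage, Set.mem_compl_iff]
    change ({x} : Set R) ⊆ ((Spec.map (CommRingCat.ofHom (algebraMap R (AdjoinRoot (X ^ 2 - C x * X))))).base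
        (π.base (W.ι.base w))).asIdeal ↔ ¬ (π.base (W.ι.base w) ∈ Scheme.regularLocus _)
    rw [hreg, not_not, Set.singleton_subset_iff, SetLike.mem_coe, hqasIdeal, Ideal.mem_comap,
      AdjoinRoot.algebraMap_eq]


/-- **`hEmb` for hypersurfaces of regular `d`-folds from good resolution in dimension `≤ d`.**  If every reduced separated
Noetherian quasi-excellent scheme of dimension `≤ d` has a good resolution (for `d = 3`: Cossart–Piltant 2019 Thm. 1.1, the tree's
`CP2019.CossartPiltant2019Thm11`; for `d ≥ 4`: OPEN, a hypothesis shape only), then for every excellent regular domain `R` of Krull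
dimension `≤ d` and every `0 ≠ x ∈ R` there is a proper surjective `π : Z' → Spec R`, an isomorphism over `D(x)`, with `π⁻¹(V(x))` a
strict normal crossings divisor — by the dimension-free engine applied to `Spec R[t]/(t² − x t)` (reduced, excellent, of Krull dimension
`dim R ≤ d`: `Doubling.isReduced` / `.isExcellentRing` / `.ringKrullDim_eq`; affine hence separated; `Stacks07QU_holds` makes it a
quasi-excellent scheme).  The `d = 3` instance is `hEmb_zeroLocus_of_thm11`. [cite: CossartPiltant2019, Thm. 1.1] -/
theorem hEmb_zeroLocus_of_goodResolutionLE (d : ℕ)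
    (hGood : ∀ (Y : Scheme.{u}) [Y.IsSeparated] [IsNoetherian Y] [IsReduced Y],
      Scheme.IsQuasiExcellent Y → topologicalKrullDim Y ≤ d → CP2019.HasGoodResolution Y)
    (R : Type u) [CommRing R] [IsDomain R] [IsRegularRing R] (hexc : IsExcellentRing R)
    (hdim : ringKrullDim R ≤ d) (x : R) (hx : x ≠ 0) :
    ∃ (Z' : Scheme.{u}) (π : Z' ⟶ Spec (.of R)), IsProper π ∧ Function.Surjective π.base ∧
      (∃ U : (Spec (.of R)).Opens,
        (U : Set ↥(Spec (.of R))) = (PrimeSpectrum.zeroLocus ({x} : Set R) : Set (PrimeSpectrum R))ᶜ ∧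
        IsIso (π ∣_ U)) ∧
      IsStrictNormalCrossingsDivisor Z'
        (π.base ⁻¹' (PrimeSpectrum.zeroLocus ({x} : Set R) : Set (PrimeSpectrum R))) := by
  -- the doubled ring is reduced, excellent (hence Noetherian, quasi-excellent) and of Krull dimension `≤ d`
  haveI hSred : _root_.IsReduced (AdjoinRoot (X ^ 2 - C x * X)) := isReduced x hx
  have hSexc : IsExcellentRing (AdjoinRoot (X ^ 2 - C x * X)) := isExcellentRing x hexc
  have hSdim : ringKrullDim (AdjoinRoot (X ^ 2 - C x * X)) ≤ d := (ringKrullDim_eq x).trans_le hdim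
  haveI hSnoeth : IsNoetherianRing (AdjoinRoot (X ^ 2 - C x * X)) := hSexc.isQuasiExcellentRing.isNoetherianRing
  haveI : IsNoetherianRing (CommRingCat.of (AdjoinRoot (X ^ 2 - C x * X))) := hSnoeth
  have hqe := Scheme.isQuasiExcellent_of_locallyOfFiniteType_of_isQuasiExcellentRing Stacks07QU_holds
    hSexc.isQuasiExcellentRing (𝟙 (Spec (.of (AdjoinRoot (X ^ 2 - C x * X)))))
  have hdim' : topologicalKrullDim ↥(Spec (.of (AdjoinRoot (X ^ 2 - C x * X)))) ≤ d :=
    (le_of_eq (PrimeSpectrum.topologicalKrullDim_eq_ringKrullDim (R := AdjoinRoot (X ^ 2 - C x * X)))).trans hSdim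
  exact hEmb_zeroLocus_of_hasGoodResolution R x hx (hGood _ hqe hdim')

end Summit.ResolutionOfSingularities.ResolutionOfSingularities.Theorems.RadicialJung.CleanModels.Doubling

end
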